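import Summits.BirchSwinnertonDyer.Rank1Residual.Additive.PadicBallLog
import Summits.BirchSwinnertonDyer.Rank1Residual.Additive.PadicClosureCyclotomicGalois
import Summits.BirchSwinnertonDyer.Rank1Residual.Additive.PadicClosureFormalGroupSeq
import Mathlib.Analysis.Normed.Unbundled.SpectralNorm
import HarnessLib

/-!
# Transport between points over the layer field `K_m = ℚ_p(ζ_{p^m})` (complete; where the
# logarithm `Λ` of `E₁` lives) and points over `ℚ̄_p` (where the Galois group acts): the embedding
# `toOmega`, its image (points with coordinates in the layer), kernel ↔ kernel, the `Ω`-valued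
# logarithm `ΛΩ(Q) = log_E(z(Q))` with **Galois equivariance** `ΛΩ(σQ) = σΛΩ(Q)`, additivity and
# "kernel = p-power torsion" on `E₁(K_m)` (cell `b2b-bsdres`, CLASS-CLOSURE lane, class O10 — x1b GEN 33,
# class lead; file 33 of the local series)

HONEST FRAMING (cell `b2b-bsdres`, run/shared/lean/b2b/bsd-rank1-residual/, verbatim in every
file): the goal of the cell is to DELETE the COMBINATION-SHAPED residual classes of the
Birch–Swinnerton-Dyer formula for ALL analytic-rank `≤ 1` elliptic curves over `ℚ` — "full BSD
formula for every rank `≤ 1` curve in class `C`" assembled STRICTLY from published theorems — so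
that the rank-`≤ 1` remainder becomes exactly the CONSTRUCTION-SHAPED classes, which are TYPED
(missing-input `Prop`s), NOT attempted. This is not "finishing BSD". CLASS-CLOSURE lane: prove
what is provable now; shrink each hard class to its core with data; no claim beyond stated classes;
research routes on CONSTRUCTION-SHAPED X12 / O10; census / instrument output = EVIDENCE / conjecture
items, NEVER a Literature fact; `RESIDUAL-MAP.md` marks change only by signed lines. THIS FILE:
TOOL DEFINITIONS + THEOREMS (definitions with bodies: the type synonym `LayerField` with its
inherited normed-field instances, `LayerField.emb`, `LayerField.mk`, `toOmega`, `bLogΩ`, `ptLogΩ`; every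
statement proved) — no named Literature fact, no Summits-side fact `def … : Prop`, no `sorry`, axioms
standard; nothing is booked; no label / mark / count / sub-cell moves; O10 stays OPEN /
CONSTRUCTION-SHAPED; nothing about `BSD(W, p)` of any pair is claimed.

## Content (`Ω = PadicAlgCl p`, `K = (LayerField p m)`, `W₀ = M ⊗ ℚ_p`, `E_Ω = W₀ ⊗ Ω`)

* §1 `LayerField p m` (type synonym of `↥(layer p m)`, complete normed `ℚ_p`-algebra); `W₀ ⊗ Ω` is
  `v`-integral; `toOmega`
  (Mathlib `Point.map` of the inclusion `K → Ω`): coordinates, injectivity, `z(toOmega P) = z(P)`,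
  image = points with coordinates in the layer (`exists_toOmega_eq`), kernel ↔ kernel.
* §2 `bLogΩ t = ∑ logₙ tⁿ ∈ Ω`, `coe_bLog` (`= bLog` on `K`), `bLogΩ (σ t) = σ (bLogΩ t)` for
  `σ ∈ Aut(Ω/ℚ_p)` (isometries: Mathlib `spectralNorm_eq_of_equiv`); `ptLogΩ Q = bLogΩ (z Q)`,
  `ptLogΩ (toOmega P) = Λ(P)`, **`ptLogΩ_pointMap`: `ΛΩ(σ • Q) = σ(ΛΩ Q)`**.
* §3 On `E₁` with coordinates in the layer: **`ptLogΩ_add`**, **`exists_pow_smul_eq_zero_of_ptLogΩ_eq_zero`**.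

References: [Kobayashi2003] §8.4; [SilvermanAEC2009] VII.2.2, IV.6.4.
-/

noncomputable section

open scoped Classical Topology NNReal
open Filter PowerSeries

namespace Summit.BirchSwinnertonDyer.Rank1Residual.Additive

namespace BallEval

open Literature.NumberTheory.GaloisRepresentations.LubinTate (unitBall mem_unitBall_iff)
open Literature.NumberTheory.EllipticCurves Literature.NumberTheory.EllipticCurves.FormalGroupChart
open WeierstrassCurve PadicCyclotomicTower

/-- **The layer field `K_m = ℚ_p(ζ_{p^m})` as a type** (a synonym of `↥(layer p m)` carrying only the
normed-field structure, so that its points use the classical decidable equality of the generic theory).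
[cite: Kobayashi2003, §8.4] -/
def LayerField (p : ℕ) [Fact p.Prime] (m : ℕ) : Type := ↥(layer p m)

namespace LayerField

variable (p : ℕ) [hp : Fact p.Prime] (m : ℕ)

/-- The normed field structure of `K_m` (induced from `Ω`). [folklore] -/
instance instNontriviallyNormedField : NontriviallyNormedField (LayerField p m) :=
  inferInstanceAs (NontriviallyNormedField ↥(layer p m))

/-- `K_m` is a normed `ℚ_p`-algebra. [folklore] -/
instance instNormedAlgebra : NormedAlgebra ℚ_[p] (LayerField p m) :=
  inferInstanceAs (NormedAlgebra ℚ_[p] ↥(layer p m))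

/-- `K_m` is ultrametric. [folklore] -/
instance instIsUltrametricDist : IsUltrametricDist (LayerField p m) :=
  inferInstanceAs (IsUltrametricDist ↥(layer p m))

/-- `K_m` is complete (finite over `ℚ_p`). [folklore] -/
instance instCompleteSpace : CompleteSpace (LayerField p m) := by
  haveI := finiteDimensional_layer p m
  exact (FiniteDimensional.complete ℚ_[p] ↥(layer p m) : CompleteSpace ↥(layer p m))

/-- The inclusion `K_m → Ω` as a `ℚ_p`-algebra map. [folklore] -/
def emb : LayerField p m →ₐ[ℚ_[p]] PadicAlgCl p := IntermediateField.val (layer p m)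

/-- An element of `Ω` lying in the layer, as an element of `K_m`. [folklore] -/
def mk (x : PadicAlgCl p) (hx : x ∈ layer p m) : LayerField p m := (⟨x, hx⟩ : ↥(layer p m))

variable {p m}

/-- `emb (mk x) = x`. [folklore] -/
@[simp] theorem emb_mk (x : PadicAlgCl p) (hx : x ∈ layer p m) : emb p m (mk p m x hx) = x := rfl

/-- `emb x ∈ layer p m`. [folklore] -/
theorem emb_mem (x : LayerField p m) : emb p m x ∈ layer p m := (show ↥(layer p m) from x).2

/-- `‖emb x‖ = ‖x‖`. [folklore] -/
theorem norm_emb (x : LayerField p m) : ‖emb p m x‖ = ‖x‖ := rfl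

/-- `emb` is injective. [folklore] -/
theorem emb_injective : Function.Injective (emb p m) := (IntermediateField.val (layer p m)).toRingHom.injective

/-- `emb` is continuous. [folklore] -/
theorem continuous_emb : Continuous (emb p m) := continuous_subtype_val

end LayerField

variable (p : ℕ) [hp : Fact p.Prime] (M : WeierstrassCurve ℤ_[p]) (m : ℕ)

/-! ## §1 The layer field and the embedding of points -/

/-- `W₀ ⊗ Ω` (`W₀ = M ⊗ ℚ_p`) has `v`-integral coefficients. [folklore] -/
theorem isIntegral_genFib_baseChange :
    ((M.map (PadicInt.Coe.ringHom (p := p))).baseChange (PadicAlgCl p)).IsIntegral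
      (Valued.v (R := PadicAlgCl p)).integer := by
  have h : ∀ c : ℤ_[p], Valued.v (algebraMap ℚ_[p] (PadicAlgCl p) (c : ℚ_[p])) ≤ 1 := fun c => by
    rw [v_le_iff_norm_le, NNReal.coe_one, norm_algebraMap']; exact PadicInt.norm_le_one c
  exact isIntegral_of_exists_lift _ ⟨⟨_, h M.a₁⟩, rfl⟩ ⟨⟨_, h M.a₂⟩, rfl⟩ ⟨⟨_, h M.a₃⟩, rfl⟩ ⟨⟨_, h M.a₄⟩, rfl⟩
    ⟨⟨_, h M.a₆⟩, rfl⟩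

/-- `curveK p K M` is (definitionally) the base change `W₀ ⊗ K`. [folklore] -/
theorem curveK_eq_baseChange (K : Type*) [NontriviallyNormedField K] [NormedAlgebra ℚ_[p] K] [IsUltrametricDist K] :
    curveK p K M = (M.map (PadicInt.Coe.ringHom (p := p))).baseChange K := rfl

/-- **The embedding of `K_m`-points into `Ω`-points** (Mathlib `Point.map` of the inclusion).
[cite: SilvermanAEC2009, VII.2.2] -/
def toOmega : (curveK p (LayerField p m) M).toAffine.Point →+
    ((M.map (PadicInt.Coe.ringHom (p := p))).baseChange (PadicAlgCl p)).toAffine.Point :=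
  Affine.Point.map (W' := M.map (PadicInt.Coe.ringHom (p := p))) (LayerField.emb p m)

variable {p M m}

/-- Nonsingularity transfers along the inclusion `K_m ⊂ Ω`. [folklore] -/
theorem nonsingular_emb {x y : LayerField p m} (h : (curveK p (LayerField p m) M).toAffine.Nonsingular x y) :
    ((M.map (PadicInt.Coe.ringHom (p := p))).baseChange (PadicAlgCl p)).toAffine.Nonsingular
      (LayerField.emb p m x) (LayerField.emb p m y) :=
  (Affine.baseChange_nonsingular (W := (M.map (PadicInt.Coe.ringHom (p := p))).toAffine)
    (f := LayerField.emb p m) LayerField.emb_injective x y).mpr h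

/-- `toOmega` on an affine point. [folklore] -/
theorem toOmega_some {x y : LayerField p m} (h : (curveK p (LayerField p m) M).toAffine.Nonsingular x y) :
    toOmega p M m (.some x y h) = .some (LayerField.emb p m x) (LayerField.emb p m y) (nonsingular_emb h) := rfl

/-- `toOmega 0 = 0`. [folklore] -/
theorem toOmega_zero' : toOmega p M m 0 = 0 := rfl

/-- `toOmega` is injective. [folklore] -/
theorem toOmega_injective : Function.Injective (toOmega p M m) :=
  Affine.Point.map_injective (W' := M.map (PadicInt.Coe.ringHom (p := p))) _

/-- `z(toOmega P) = z(P)`. [folklore] -/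
theorem zCoord_toOmega (P : (curveK p (LayerField p m) M).toAffine.Point) :
    (toOmega p M m P).zCoord = LayerField.emb p m P.zCoord := by
  rcases P with _ | ⟨x, y, h⟩
  · change (0 : ((M.map (PadicInt.Coe.ringHom (p := p))).baseChange (PadicAlgCl p)).toAffine.Point).zCoord =
      LayerField.emb p m (0 : (curveK p (LayerField p m) M).toAffine.Point).zCoord
    rw [Affine.Point.zCoord_zero, Affine.Point.zCoord_zero, map_zero]
  · rw [toOmega_some, Affine.Point.zCoord_some, Affine.Point.zCoord_some, map_div₀, map_neg]

/-- The coefficients of `W₀ ⊗ Ω` lie in every layer (they lie in `ℚ_p`). [folklore] -/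
theorem coeffs_mem_layer :
    ((M.map (PadicInt.Coe.ringHom (p := p))).baseChange (PadicAlgCl p)).a₁ ∈ (layer p m).toSubfield ∧
    ((M.map (PadicInt.Coe.ringHom (p := p))).baseChange (PadicAlgCl p)).a₂ ∈ (layer p m).toSubfield ∧
    ((M.map (PadicInt.Coe.ringHom (p := p))).baseChange (PadicAlgCl p)).a₃ ∈ (layer p m).toSubfield ∧
    ((M.map (PadicInt.Coe.ringHom (p := p))).baseChange (PadicAlgCl p)).a₄ ∈ (layer p m).toSubfield ∧
    ((M.map (PadicInt.Coe.ringHom (p := p))).baseChange (PadicAlgCl p)).a₆ ∈ (layer p m).toSubfield := by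
  simp only [baseChange, map_a₁, map_a₂, map_a₃, map_a₄, map_a₆]
  exact ⟨IntermediateField.algebraMap_mem _ _, IntermediateField.algebraMap_mem _ _, IntermediateField.algebraMap_mem _ _,
    IntermediateField.algebraMap_mem _ _, IntermediateField.algebraMap_mem _ _⟩

/-- The image of `toOmega` consists of points with coordinates in the layer. [folklore] -/
theorem toOmega_mem_subfieldPoints (P : (curveK p (LayerField p m) M).toAffine.Point) :
    toOmega p M m P ∈ subfieldPoints ((M.map (PadicInt.Coe.ringHom (p := p))).baseChange (PadicAlgCl p)) (layer p m).toSubfield coeffs_mem_layer := by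
  rcases P with _ | ⟨x, y, h⟩
  · exact (subfieldPoints _ _ coeffs_mem_layer).zero_mem
  · rw [toOmega_some, some_mem_subfieldPoints_iff]
    exact ⟨LayerField.emb_mem x, LayerField.emb_mem y⟩

/-- **Every `Ω`-point with coordinates in the layer is in the image of `toOmega`.** [folklore] -/
theorem exists_toOmega_eq {Q : ((M.map (PadicInt.Coe.ringHom (p := p))).baseChange (PadicAlgCl p)).toAffine.Point}
    (hQ : Q ∈ subfieldPoints ((M.map (PadicInt.Coe.ringHom (p := p))).baseChange (PadicAlgCl p)) (layer p m).toSubfield coeffs_mem_layer) :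
    ∃ P : (curveK p (LayerField p m) M).toAffine.Point, toOmega p M m P = Q := by
  rcases Q with _ | ⟨x, y, h⟩
  · exact ⟨0, rfl⟩
  · obtain ⟨hx, hy⟩ := (some_mem_subfieldPoints_iff _ h).mp hQ
    have h' : (curveK p (LayerField p m) M).toAffine.Nonsingular (LayerField.mk p m x hx) (LayerField.mk p m y hy) :=
      (Affine.baseChange_nonsingular (W := (M.map (PadicInt.Coe.ringHom (p := p))).toAffine)
        (f := LayerField.emb p m) LayerField.emb_injective (LayerField.mk p m x hx) (LayerField.mk p m y hy)).mp h
    exact ⟨.some _ _ h', rfl⟩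

variable [hintΩ : ((M.map (PadicInt.Coe.ringHom (p := p))).baseChange (PadicAlgCl p)).IsIntegral
    (Valued.v (R := PadicAlgCl p)).integer]
  [hint : (curveK p (LayerField p m) M).IsIntegral (NormedField.valuation (K := (LayerField p m))).integer]

/-- **Kernel ↔ kernel**: `toOmega P ∈ E₁(Ω) ↔ P ∈ E₁(K_m)`. [folklore] -/
theorem toOmega_mem_kernel_iff (P : (curveK p (LayerField p m) M).toAffine.Point) :
    toOmega p M m P ∈ kernel (Valued.v (R := PadicAlgCl p)) ((M.map (PadicInt.Coe.ringHom (p := p))).baseChange (PadicAlgCl p)) ↔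
      P ∈ kernel (NormedField.valuation (K := (LayerField p m))) (curveK p (LayerField p m) M) := by
  rcases P with _ | ⟨x, y, h⟩
  · exact ⟨fun _ => (kernel (NormedField.valuation (K := (LayerField p m))) (curveK p (LayerField p m) M)).zero_mem,
      fun _ => (kernel (Valued.v (R := PadicAlgCl p))
        ((M.map (PadicInt.Coe.ringHom (p := p))).baseChange (PadicAlgCl p))).zero_mem⟩
  · rw [toOmega_some, some_mem_kernel_iff, some_mem_kernel_iff, v_lt_iff_norm_lt' , ← NNReal.coe_lt_coe,
      NormedField.valuation_apply, coe_nnnorm, NNReal.coe_one, LayerField.norm_emb]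
where
  /-- `1 < v x ↔ 1 < ‖x‖` in `Ω`. [folklore] -/
  v_lt_iff_norm_lt' {x : PadicAlgCl p} : (1 : ℝ≥0) < Valued.v x ↔ (1 : ℝ) < ‖x‖ := by
    rw [PadicAlgCl.valuation_def, ← NNReal.coe_lt_coe, coe_nnnorm, NNReal.coe_one]

/-! ## §2 The `Ω`-valued logarithm and Galois equivariance -/

variable (p M) in
/-- **`bLogΩ t = ∑ₙ logₙ tⁿ ∈ Ω`** (the same series as `bLog`, summed in `Ω`). [cite: Kobayashi2003, §8.4] -/
def bLogΩ (t : PadicAlgCl p) : PadicAlgCl p :=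
  ∑' n : ℕ, algebraMap ℚ_[p] (PadicAlgCl p) (coeff n (logQ p M)) * t ^ n

omit hintΩ hint in
/-- `bLog` on the layer, viewed in `Ω`, is `bLogΩ`. [folklore] -/
theorem emb_bLog {t : LayerField p m} (ht : ‖t‖ < 1) :
    LayerField.emb p m (bLog p (LayerField p m) M t) = bLogΩ p M (LayerField.emb p m t) := by
  have h := (hasSum_qEval (K := LayerField p m) (norm_coeff_logQ_le (p := p) (M := M)) ht).map
    (LayerField.emb p m) LayerField.continuous_emb
  have e : ((LayerField.emb p m) ∘ fun n : ℕ =>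
      algebraMap ℚ_[p] (LayerField p m) (coeff n (logQ p M)) * t ^ n) =
      fun n : ℕ => algebraMap ℚ_[p] (PadicAlgCl p) (coeff n (logQ p M)) * (LayerField.emb p m t) ^ n := by
    funext n
    simp only [Function.comp_apply, map_mul, map_pow, AlgHom.commutes]
  have h' := e ▸ h
  rw [bLogΩ, h'.tsum_eq]
  rfl

omit hintΩ hint in
/-- **`bLogΩ (σ t) = σ (bLogΩ t)`** for `‖t‖ < 1` (coefficients in `ℚ_p`, `σ` continuous). [folklore] -/
theorem bLogΩ_algEquiv (σ : PadicAlgCl p ≃ₐ[ℚ_[p]] PadicAlgCl p) {t : PadicAlgCl p} (ht : ‖t‖ < 1) :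
    bLogΩ p M (σ t) = σ (bLogΩ p M t) := by
  -- summability in `Ω` via the complete subfield `ℚ_p(t)`
  set F : IntermediateField ℚ_[p] (PadicAlgCl p) := IntermediateField.adjoin ℚ_[p] {t} with hF
  haveI : FiniteDimensional ℚ_[p] F := IntermediateField.adjoin.finiteDimensional (Algebra.IsIntegral.isIntegral t)
  haveI : CompleteSpace F := FiniteDimensional.complete ℚ_[p] F
  have htF : t ∈ F := IntermediateField.mem_adjoin_simple_self ℚ_[p] t
  set t' : F := ⟨t, htF⟩
  have ht' : ‖t'‖ < 1 := ht
  have hs : HasSum (fun n : ℕ => algebraMap ℚ_[p] (PadicAlgCl p) (coeff n (logQ p M)) * t ^ n) (bLogΩ p M t) := by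
    have h := (hasSum_qEval (K := ↥F) (norm_coeff_logQ_le (p := p) (M := M)) ht').map
      (IntermediateField.val F) continuous_subtype_val
    have e : ((IntermediateField.val F) ∘ fun n : ℕ => algebraMap ℚ_[p] (↥F) (coeff n (logQ p M)) * t' ^ n) =
        fun n : ℕ => algebraMap ℚ_[p] (PadicAlgCl p) (coeff n (logQ p M)) * t ^ n := by
      funext n
      simp only [Function.comp_apply, map_mul, map_pow, AlgHom.commutes]
      rfl
    have h' := e ▸ h
    rw [bLogΩ, h'.tsum_eq]; exact h'
  -- `σ` is an isometry (Mathlib `spectralNorm_eq_of_equiv`), hence continuous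
  have hσc : Continuous σ := by
    refine AddMonoidHomClass.continuous_of_bound σ 1 fun x => ?_
    rw [one_mul, ← PadicAlgCl.spectralNorm_eq, ← PadicAlgCl.spectralNorm_eq]
    exact (spectralNorm_eq_of_equiv σ x).symm.le
  have h2 := hs.map σ hσc
  have e2 : (σ : PadicAlgCl p → PadicAlgCl p) ∘ (fun n : ℕ => algebraMap ℚ_[p] (PadicAlgCl p) (coeff n (logQ p M)) * t ^ n) =
      fun n : ℕ => algebraMap ℚ_[p] (PadicAlgCl p) (coeff n (logQ p M)) * (σ t) ^ n := by
    funext n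
    simp only [Function.comp_apply, map_mul, map_pow, AlgEquiv.commutes]
  rw [e2] at h2
  rw [bLogΩ, h2.tsum_eq]

variable (p M) in
/-- **`ΛΩ(Q) = log_E(z(Q)) ∈ Ω`**, the logarithm read on `Ω`-points. [cite: Kobayashi2003, §8.4] -/
def ptLogΩ (Q : ((M.map (PadicInt.Coe.ringHom (p := p))).baseChange (PadicAlgCl p)).toAffine.Point) : PadicAlgCl p :=
  bLogΩ p M Q.zCoord

omit hintΩ in
/-- `ΛΩ(toOmega P) = Λ(P)` for `P ∈ E₁(K_m)`. [folklore] -/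
theorem ptLogΩ_toOmega {P : (curveK p (LayerField p m) M).toAffine.Point}
    (hP : P ∈ kernel (NormedField.valuation (K := LayerField p m)) (curveK p (LayerField p m) M)) :
    ptLogΩ p M (toOmega p M m P) = LayerField.emb p m (ptLog p (LayerField p m) M P) := by
  rw [ptLogΩ, zCoord_toOmega, ptLog, emb_bLog (norm_zCoord_lt_one hP)]

omit hintΩ hint in
/-- `z(σ • Q) = σ(z Q)` for the coordinatewise action `Point.map σ`. [folklore] -/
theorem zCoord_pointMap (σ : PadicAlgCl p ≃ₐ[ℚ_[p]] PadicAlgCl p)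
    (Q : ((M.map (PadicInt.Coe.ringHom (p := p))).baseChange (PadicAlgCl p)).toAffine.Point) :
    (Affine.Point.map (σ : PadicAlgCl p →ₐ[ℚ_[p]] PadicAlgCl p) Q).zCoord = σ Q.zCoord := by
  rcases Q with _ | ⟨x, y, h⟩
  · change (0 : ((M.map (PadicInt.Coe.ringHom (p := p))).baseChange (PadicAlgCl p)).toAffine.Point).zCoord = σ 0
    rw [Affine.Point.zCoord_zero, map_zero]
  · rw [Affine.Point.map_some, Affine.Point.zCoord_some, Affine.Point.zCoord_some, map_div₀, map_neg]
    rfl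

omit hintΩ hint in
/-- **Galois equivariance of the logarithm: `ΛΩ(σ • Q) = σ(ΛΩ Q)`** for `‖z Q‖ < 1`.
[cite: Kobayashi2003, §8.4] -/
theorem ptLogΩ_pointMap (σ : PadicAlgCl p ≃ₐ[ℚ_[p]] PadicAlgCl p)
    {Q : ((M.map (PadicInt.Coe.ringHom (p := p))).baseChange (PadicAlgCl p)).toAffine.Point} (hQ : ‖Q.zCoord‖ < 1) :
    ptLogΩ p M (Affine.Point.map (σ : PadicAlgCl p →ₐ[ℚ_[p]] PadicAlgCl p) Q) = σ (ptLogΩ p M Q) := by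
  rw [ptLogΩ, ptLogΩ, zCoord_pointMap, bLogΩ_algEquiv σ hQ]

/-! ## §3 Additivity and torsion on `E₁` with coordinates in the layer -/

variable [hE : (M.map PadicInt.Coe.ringHom).IsElliptic]

/-- **Additivity of `ΛΩ` on `E₁(Ω)`-points with coordinates in the layer.** [cite: SilvermanAEC2009, IV.6.4] -/
theorem ptLogΩ_add
    {Q₁ Q₂ : ((M.map (PadicInt.Coe.ringHom (p := p))).baseChange (PadicAlgCl p)).toAffine.Point}
    (h₁ : Q₁ ∈ subfieldPoints ((M.map (PadicInt.Coe.ringHom (p := p))).baseChange (PadicAlgCl p)) (layer p m).toSubfield coeffs_mem_layer)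
    (h₂ : Q₂ ∈ subfieldPoints ((M.map (PadicInt.Coe.ringHom (p := p))).baseChange (PadicAlgCl p)) (layer p m).toSubfield coeffs_mem_layer)
    (hk₁ : Q₁ ∈ kernel (Valued.v (R := PadicAlgCl p)) ((M.map (PadicInt.Coe.ringHom (p := p))).baseChange (PadicAlgCl p)))
    (hk₂ : Q₂ ∈ kernel (Valued.v (R := PadicAlgCl p)) ((M.map (PadicInt.Coe.ringHom (p := p))).baseChange (PadicAlgCl p))) :
    ptLogΩ p M (Q₁ + Q₂) = ptLogΩ p M Q₁ + ptLogΩ p M Q₂ := by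
  obtain ⟨P₁, rfl⟩ := exists_toOmega_eq h₁
  obtain ⟨P₂, rfl⟩ := exists_toOmega_eq h₂
  have hP₁ : P₁ ∈ kernel (NormedField.valuation (K := (LayerField p m))) (curveK p (LayerField p m) M) :=
    (toOmega_mem_kernel_iff P₁).mp hk₁
  have hP₂ : P₂ ∈ kernel (NormedField.valuation (K := (LayerField p m))) (curveK p (LayerField p m) M) :=
    (toOmega_mem_kernel_iff P₂).mp hk₂
  rw [← map_add, ptLogΩ_toOmega hP₁, ptLogΩ_toOmega hP₂,
    ptLogΩ_toOmega ((kernel (NormedField.valuation (K := LayerField p m)) (curveK p (LayerField p m) M)).add_mem hP₁ hP₂),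
    ptLog_add hP₁ hP₂, map_add]

/-- **`ΛΩ(Q) = 0 ⇒ p^k • Q = 0`** for `Q ∈ E₁(Ω)` with coordinates in the layer. [cite: SilvermanAEC2009, IV.6.4] -/
theorem exists_pow_smul_eq_zero_of_ptLogΩ_eq_zero
    {Q : ((M.map (PadicInt.Coe.ringHom (p := p))).baseChange (PadicAlgCl p)).toAffine.Point}
    (hQ : Q ∈ subfieldPoints ((M.map (PadicInt.Coe.ringHom (p := p))).baseChange (PadicAlgCl p)) (layer p m).toSubfield coeffs_mem_layer)
    (hk : Q ∈ kernel (Valued.v (R := PadicAlgCl p)) ((M.map (PadicInt.Coe.ringHom (p := p))).baseChange (PadicAlgCl p)))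
    (h0 : ptLogΩ p M Q = 0) : ∃ k : ℕ, p ^ k • Q = 0 := by
  obtain ⟨P, rfl⟩ := exists_toOmega_eq hQ
  have hP : P ∈ kernel (NormedField.valuation (K := (LayerField p m))) (curveK p (LayerField p m) M) :=
    (toOmega_mem_kernel_iff P).mp hk
  rw [ptLogΩ_toOmega hP, map_eq_zero_iff _ LayerField.emb_injective] at h0
  have h0' : ptLog p (LayerField p m) M P = 0 := h0
  obtain ⟨k, hk'⟩ := exists_pow_smul_eq_zero_of_ptLog_eq_zero hP h0'
  exact ⟨k, by rw [← map_nsmul, hk', map_zero]⟩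

end BallEval

end Summit.BirchSwinnertonDyer.Rank1Residual.Additive

end
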